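import Summits.KontsevichZagierPeriods.KontsevichZagierPeriods.Theorems.SoloBlindTriplSecond
import HarnessLib

/-!
# Solo/blind — Triplication IV (prep): the pull-back for `3a+b=3` and the primitive `ρ₂`

For `3a+b=3` the pull-back of `β(a,b)` along `t = Ψ(u)` is `3^{b-1}·P₂(u)`,
`P₂ = u^{2a-3} q^{b-3} (1+q)(1-q)²`, `q = (1-u)^{1/3}` (`tri_pullback2`), never termwise
integrable.  The repairing primitive is

  `ρ₂(u) = u^{2a-1} q^b (2+q)/(1+q+q²) = u^{2a-2} q^b (1-q)(2+q)`,  `ρ₂(0) = ρ₂(1) = 0` (`a > 1/2`),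

with `ρ₂' = (2a-2)·P₂ + W₂` on `(0,1)`,
`W₂ = ((3a-2)/3)·u^{2a-2}q^{b-2} + ((3a-1)/3)·u^{2a-2}q^{b-1}` (`hasDerivAt_triRho2`).
The chain itself is assembled in `SoloBlindTriplThird`.
-/

namespace Summit.KontsevichZagierPeriods.KontsevichZagierPeriods.Theorems

open Literature.NumberTheory.Transcendental Literature.NumberTheory.Transcendental.KZ
open Literature.NumberTheory.Transcendental.KZ.IntegralRep
open Literature.ModelTheory.ExponentialFields
open MeasureTheory Set Real Polynomial

noncomputable section

namespace SoloBlind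

variable {a b : ℚ}

/-! ## The pull-back for `3a+b=3` -/

/-- `3a + b = 3`: `(1-q)^{2a-1} s^{-a-b} = u^{2a-3}(1-q)²`. -/
theorem tri_e2 (a b : ℚ) (h : 3 * a + b = 3) {u : ℝ} (h0 : 0 < u) (h1 : u < 1) :
    (1 - triQ u) ^ (2 * (a : ℝ) - 1) * (1 + triQ u + triQ u * triQ u) ^ (-((a : ℝ) + b)) =
      u ^ (2 * (a : ℝ) - 2 - 1) * (1 - triQ u) ^ 2 := by
  have h' : -((a : ℝ) + b) = 2 * (a : ℝ) - 2 - 1 := by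
    have := congrArg (Rat.cast : ℚ → ℝ) h
    push_cast at this
    linarith
  have h1q : 0 < 1 - triQ u := by linarith [triQ_lt_one h0 h1.le]
  have hp : (1 - triQ u) ^ (2 * (a : ℝ) - 1) =
      (1 - triQ u) ^ (2 * (a : ℝ) - 2 - 1) * (1 - triQ u) ^ 2 := by
    rw [← Real.rpow_two, ← Real.rpow_add h1q]; congr 1; ring
  rw [h', hp, mul_right_comm, ← Real.mul_rpow h1q.le (tri_s_pos u).le, ← tri_u_eq h1.le]

/-- `P₂ = u^{2a-3} q^{b-3}(1 - q - q² + q³)` as a combination of four Beta-type monomials. -/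
def triP2 (a b : ℚ) (u : ℝ) : ℝ :=
  betaFun (2 * a - 2) (b / 3) u - betaFun (2 * a - 2) ((b + 1) / 3) u -
    betaFun (2 * a - 2) ((b + 2) / 3) u + betaFun (2 * a - 2) ((b + 3) / 3) u

/-- The pull-back `3^{b-1} P₂`. -/
def triF2 (a b : ℚ) (u : ℝ) : ℝ := (3:ℝ) ^ ((b : ℝ) - 1) * triP2 a b u

/-- **Pull-back for `3a + b = 3`**: `3^{b-1} P₂ = Ψ^{a-1}(1-Ψ)^{b-1}|Ψ'|` on `(0,1)`. -/
theorem tri_pullback2 (a b : ℚ) (h : 3 * a + b = 3) {u : ℝ} (hu : u ∈ Ioo (0:ℝ) 1) :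
    triF2 a b u = betaFun a b (triPsi u) * |triPsi' u| := by
  obtain ⟨h0, h1⟩ := hu
  have hq0 := triQ_pos h1
  have e0 : (1 - u) ^ ((b : ℝ) / 3 - 1) = triQ u ^ ((b : ℝ) - 3) := by
    rw [triQ_rpow h1.le]; congr 1; ring
  have e1 : (1 - u) ^ (((b : ℝ) + 1) / 3 - 1) = triQ u ^ ((b : ℝ) - 3) * triQ u := by
    rw [← Real.rpow_add_one hq0.ne', triQ_rpow h1.le]; congr 1; ring
  have e2 : (1 - u) ^ (((b : ℝ) + 2) / 3 - 1) = triQ u ^ ((b : ℝ) - 3) * triQ u ^ 2 := by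
    rw [← Real.rpow_two, ← Real.rpow_add hq0, triQ_rpow h1.le]; congr 1; ring
  have e3 : (1 - u) ^ (((b : ℝ) + 3) / 3 - 1) = triQ u ^ ((b : ℝ) - 3) * triQ u ^ 3 := by
    rw [← Real.rpow_natCast _ 3, ← Real.rpow_add hq0, triQ_rpow h1.le]; congr 1; push_cast; ring
  rw [tri_core a b h0 h1, tri_e2 a b h h0 h1]
  unfold triF2 triP2 betaFun
  push_cast
  rw [e0, e1, e2, e3]
  ring

/-- `3^{b-1} P₂` is integrable on `(0,1)` (`a, b > 0`, `3a+b=3`), by change of variables. -/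
theorem integrableOn_triF2 (a b : ℚ) (ha : 0 < a) (hb : 0 < b) (h : 3 * a + b = 3) :
    IntegrableOn (triF2 a b) (Ioo 0 1) :=
  (integrableOn_triPull a b ha hb).congr_fun (fun _ hu => (tri_pullback2 a b h hu).symm)
    measurableSet_Ioo

/-- `P₂` is integrable on `(0,1)`. -/
theorem integrableOn_triP2 (a b : ℚ) (ha : 0 < a) (hb : 0 < b) (h : 3 * a + b = 3) :
    IntegrableOn (triP2 a b) (Ioo 0 1) := by
  have h3 : (3:ℝ) ^ ((b : ℝ) - 1) ≠ 0 := (Real.rpow_pos_of_pos (by norm_num) _).ne'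
  refine IntegrableOn.congr_fun ((integrableOn_triF2 a b ha hb h).div_const
    ((3:ℝ) ^ ((b : ℝ) - 1))) (fun u _ => ?_) measurableSet_Ioo
  simp only [triF2]
  rw [mul_div_cancel_left₀ _ h3]

/-- `P₂` is `ℚ`-semialgebraic on `(0,1)`. -/
theorem sa_triP2 (a b : ℚ) :
    IsSemialgebraicFunOn ℚ (line (Ioo (0:ℝ) 1)) (fun x : Fin 1 → ℝ => triP2 a b (x 0)) :=
  ((IsSemialgebraicFunOn.sub_holds (isSemialgebraicFunOn_betaFun' (2 * a - 2) (b / 3))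
    (isSemialgebraicFunOn_betaFun' (2 * a - 2) ((b + 1) / 3))).sub_holds
    (isSemialgebraicFunOn_betaFun' (2 * a - 2) ((b + 2) / 3))).add_holds
    (isSemialgebraicFunOn_betaFun' (2 * a - 2) ((b + 3) / 3))

/-! ## `W₂` and the primitive `ρ₂` -/

/-- `W₂ = ((3a-2)/3) u^{2a-2} q^{b-2} + ((3a-1)/3) u^{2a-2} q^{b-1}`. -/
def triW2 (a b : ℚ) (u : ℝ) : ℝ :=
  (((3 * a - 2) / 3 : ℚ) : ℝ) * betaFun (2 * a - 1) ((b + 1) / 3) u +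
    (((3 * a - 1) / 3 : ℚ) : ℝ) * betaFun (2 * a - 1) ((b + 2) / 3) u

/-- The primitive `ρ₂(u) = u^{2a-1} q^b (2+q)/(1+q+q²)`. -/
def triRho2 (a b : ℚ) (u : ℝ) : ℝ :=
  u ^ (2 * (a : ℝ) - 1) * (triQ u ^ (b : ℝ) * ((2 + triQ u) / (1 + triQ u + triQ u * triQ u)))

/-- The exact integrand `ρ₂' = (2a-2) P₂ + W₂` on `(0,1)`, extended by `0`. -/
def triE2 (a b : ℚ) (u : ℝ) : ℝ :=
  if u ∈ Ioo (0:ℝ) 1 then (((2 * a - 2 : ℚ)) : ℝ) * triP2 a b u + triW2 a b u else 0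

/-- `W₂` is integrable on `(0,1)` (`a > 1/2`, `b > 0`). -/
theorem integrableOn_triW2 (a b : ℚ) (ha : 1 / 2 < a) (hb : 0 < b) :
    IntegrableOn (triW2 a b) (Ioo 0 1) :=
  ((integrableOn_betaFun (2 * a - 1) ((b + 1) / 3) (by linarith) (by positivity)).const_mul _).add
    ((integrableOn_betaFun (2 * a - 1) ((b + 2) / 3) (by linarith) (by positivity)).const_mul _)

/-- `W₂` is `ℚ`-semialgebraic on `(0,1)`. -/
theorem sa_triW2 (a b : ℚ) :
    IsSemialgebraicFunOn ℚ (line (Ioo (0:ℝ) 1)) (fun x : Fin 1 → ℝ => triW2 a b (x 0)) :=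
  IsSemialgebraicFunOn.add_holds
    (IsSemialgebraicFunOn.mul_holds
      (isSemialgebraicFunOn_const_of_isAlgebraic mix_line_sa (isAlgebraic_rat ℚ _))
      (isSemialgebraicFunOn_betaFun' (2 * a - 1) ((b + 1) / 3)))
    (IsSemialgebraicFunOn.mul_holds
      (isSemialgebraicFunOn_const_of_isAlgebraic mix_line_sa (isAlgebraic_rat ℚ _))
      (isSemialgebraicFunOn_betaFun' (2 * a - 1) ((b + 2) / 3)))

/-- `ρ₂(0) = 0` (`a > 1/2`). -/
theorem triRho2_zero (ha : 1 / 2 < a) : triRho2 a b 0 = 0 := by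
  have h2 : (1 : ℚ) < 2 * a := by linarith
  have h2a : (2 * (a : ℝ) - 1) ≠ 0 := by
    have : (1 : ℝ) < 2 * (a : ℝ) := by exact_mod_cast h2
    linarith
  simp [triRho2, Real.zero_rpow h2a]

/-- `ρ₂(1) = 0` (`b > 0`). -/
theorem triRho2_one (hb : 0 < b) : triRho2 a b 1 = 0 := by
  have hb' : (b : ℝ) ≠ 0 := by exact_mod_cast hb.ne'
  simp [triRho2, triQ_one, Real.zero_rpow hb']

/-- `ρ₂` is continuous on `ℝ` (`a > 1/2`, `b > 0`). -/
theorem continuous_triRho2 (ha : 1 / 2 < a) (hb : 0 < b) : Continuous (triRho2 a b) := by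
  have h2 : (1 : ℚ) < 2 * a := by linarith
  have h2a : (0:ℝ) ≤ 2 * (a : ℝ) - 1 := by
    have : (1 : ℝ) < 2 * (a : ℝ) := by exact_mod_cast h2
    linarith
  have hb' : (0:ℝ) ≤ (b : ℝ) := by exact_mod_cast hb.le
  unfold triRho2
  exact (Real.continuous_rpow_const h2a).mul
    ((continuous_triQ.rpow_const fun _ => Or.inr hb').mul
      ((continuous_const.add continuous_triQ).div
        ((continuous_const.add continuous_triQ).add (continuous_triQ.mul continuous_triQ))
        fun u => (tri_s_pos u).ne'))

/-- On `(0,1)`: `ρ₂ = 2u^{2a-2}(1-u)^{b/3} - u^{2a-2}(1-u)^{(b+1)/3} - u^{2a-2}(1-u)^{(b+2)/3}`. -/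
theorem triRho2_eq {u : ℝ} (hu : u ∈ Ioo (0:ℝ) 1) :
    triRho2 a b u = 2 * (u ^ (2 * (a : ℝ) - 2) * (1 - u) ^ ((b : ℝ) / 3)) -
      u ^ (2 * (a : ℝ) - 2) * (1 - u) ^ (((b : ℝ) + 1) / 3) -
      u ^ (2 * (a : ℝ) - 2) * (1 - u) ^ (((b : ℝ) + 2) / 3) := by
  obtain ⟨h0, h1⟩ := hu
  unfold triRho2
  set q := triQ u with hq
  have hq0 : 0 < q := triQ_pos h1
  have hs : (0:ℝ) < 1 + q + q * q := by rw [hq]; exact tri_s_pos u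
  have hus : u = (1 - q) * (1 + q + q * q) := by rw [hq]; exact tri_u_eq h1.le
  have e1 : (1 - u) ^ ((b : ℝ) / 3) = q ^ (b : ℝ) := by rw [hq, triQ_rpow h1.le]
  have e2 : (1 - u) ^ (((b : ℝ) + 1) / 3) = q ^ (b : ℝ) * q := by
    rw [← Real.rpow_add_one hq0.ne', hq, triQ_rpow h1.le]
  have e3 : (1 - u) ^ (((b : ℝ) + 2) / 3) = q ^ (b : ℝ) * q ^ 2 := by
    rw [← Real.rpow_two, ← Real.rpow_add hq0, hq, triQ_rpow h1.le]
  have e4 : u ^ (2 * (a : ℝ) - 1) = u ^ (2 * (a : ℝ) - 2) * u := by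
    rw [← Real.rpow_add_one h0.ne']; congr 1; ring
  have key : u * ((2 + q) / (1 + q + q * q)) = (1 - q) * (2 + q) := by
    rw [hus]; field_simp
  rw [e1, e2, e3, e4]
  calc u ^ (2 * (a : ℝ) - 2) * u * (q ^ (b : ℝ) * ((2 + q) / (1 + q + q * q)))
      = u ^ (2 * (a : ℝ) - 2) * q ^ (b : ℝ) * (u * ((2 + q) / (1 + q + q * q))) := by ring
    _ = _ := by rw [key]; ring

/-- **`ρ₂' = (2a-2) P₂ + W₂` on `(0,1)`** (`3a+b=3`), using `q³ = 1-u`. -/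
theorem hasDerivAt_triRho2 (h : 3 * a + b = 3) {u : ℝ} (hu : u ∈ Ioo (0:ℝ) 1) :
    HasDerivAt (triRho2 a b) ((((2 * a - 2 : ℚ)) : ℝ) * triP2 a b u + triW2 a b u) u := by
  obtain ⟨h0, h1⟩ := hu
  have hb : (b : ℝ) = 3 - 3 * a := by
    have := congrArg (fun x : ℚ => (x : ℝ)) h; push_cast at this; linarith
  have hF : triRho2 a b =ᶠ[nhds u] fun v => 2 * (v ^ (2 * (a : ℝ) - 2) * (1 - v) ^ ((b : ℝ) / 3)) -
      v ^ (2 * (a : ℝ) - 2) * (1 - v) ^ (((b : ℝ) + 1) / 3) -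
      v ^ (2 * (a : ℝ) - 2) * (1 - v) ^ (((b : ℝ) + 2) / 3) :=
    Filter.eventually_iff_exists_mem.mpr ⟨Ioo 0 1, Ioo_mem_nhds h0 h1, fun v hv => triRho2_eq hv⟩
  refine (((((hasDerivAt_rpow_mul_one_sub_rpow (a := 2 * (a : ℝ) - 2) (b := (b : ℝ) / 3)
    ⟨h0, h1⟩).const_mul 2).sub (hasDerivAt_rpow_mul_one_sub_rpow (a := 2 * (a : ℝ) - 2)
    (b := ((b : ℝ) + 1) / 3) ⟨h0, h1⟩)).sub (hasDerivAt_rpow_mul_one_sub_rpow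
    (a := 2 * (a : ℝ) - 2) (b := ((b : ℝ) + 2) / 3) ⟨h0, h1⟩)).congr_of_eventuallyEq
    hF).congr_deriv ?_
  set q := triQ u with hq
  have hq0 : 0 < q := triQ_pos h1
  have hq3 : q ^ 3 = 1 - u := by rw [hq]; exact triQ_cube h1.le
  set Y := q ^ ((b : ℝ) - 3) with hY
  have eB : (1 - u) ^ ((b : ℝ) / 3 - 1) = Y := by
    rw [hY, hq, triQ_rpow h1.le]; congr 1; ring
  have eA : (1 - u) ^ ((b : ℝ) / 3) = Y * q ^ 3 := by
    rw [hY, ← Real.rpow_natCast q 3, ← Real.rpow_add hq0, hq, triQ_rpow h1.le]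
    congr 1; push_cast; ring
  have eD : (1 - u) ^ (((b : ℝ) + 1) / 3 - 1) = Y * q := by
    rw [hY, ← Real.rpow_add_one hq0.ne', hq, triQ_rpow h1.le]; congr 1; ring
  have eC : (1 - u) ^ (((b : ℝ) + 1) / 3) = Y * q ^ 4 := by
    rw [hY, ← Real.rpow_natCast q 4, ← Real.rpow_add hq0, hq, triQ_rpow h1.le]
    congr 1; push_cast; ring
  have eF : (1 - u) ^ (((b : ℝ) + 2) / 3 - 1) = Y * q ^ 2 := by
    rw [hY, ← Real.rpow_natCast q 2, ← Real.rpow_add hq0, hq, triQ_rpow h1.le]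
    congr 1; push_cast; ring
  have eE : (1 - u) ^ (((b : ℝ) + 2) / 3) = Y * q ^ 5 := by
    rw [hY, ← Real.rpow_natCast q 5, ← Real.rpow_add hq0, hq, triQ_rpow h1.le]
    congr 1; push_cast; ring
  have eG : (1 - u) ^ (((b : ℝ) + 3) / 3 - 1) = Y * q ^ 3 := by
    rw [hY, ← Real.rpow_natCast q 3, ← Real.rpow_add hq0, hq, triQ_rpow h1.le]
    congr 1; push_cast; ring
  have eU : u ^ (2 * (a : ℝ) - 2) = u ^ (2 * (a : ℝ) - 2 - 1) * u := by
    rw [← Real.rpow_add_one h0.ne']; congr 1; ring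
  have eU' : u ^ (2 * (a : ℝ) - 1 - 1) = u ^ (2 * (a : ℝ) - 2 - 1) * u := by
    rw [← Real.rpow_add_one h0.ne']; congr 1; ring
  simp only [triP2, triW2, betaFun]
  push_cast
  rw [eA, eB, eC, eD, eE, eF, eG, eU, eU', hb]
  linear_combination
    (u ^ (2 * (a : ℝ) - 2 - 1) * Y * (2 * (a : ℝ) - 2) * (1 - q - q ^ 2)) * hq3

/-- `ρ₂` is `ℚ`-semialgebraic on `[0,1]`. -/
theorem sa_triRho2 (ha : 1 / 2 < a) (hb : 0 < b) :
    IsSemialgebraicFunOn ℚ (line (Icc 0 1)) fun x => triRho2 a b (x 0) := by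
  refine isSemialgebraicFunOn_Icc_of_Ioo ?_ 0 0 (fun x hx => ?_) (fun x hx => ?_)
  · refine (((isSemialgebraicFunOn_const_mul_rpow_mul_rpow 2 (2 * a - 2) (b / 3)).fun_sub
      (isSemialgebraicFunOn_const_mul_rpow_mul_rpow 1 (2 * a - 2) ((b + 1) / 3))).fun_sub
      (isSemialgebraicFunOn_const_mul_rpow_mul_rpow 1 (2 * a - 2) ((b + 2) / 3))).congr
      fun x hx => ?_
    have hx' : x 0 ∈ Ioo (0 : ℝ) 1 := hx
    beta_reduce
    rw [triRho2_eq hx']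
    push_cast
    ring
  · rw [hx, triRho2_zero ha, Rat.cast_zero]
  · rw [hx, triRho2_one hb, Rat.cast_zero]

/-- `ρ₂'` (extended by `0`) is `ℚ`-semialgebraic on `[0,1]`. -/
theorem sa_triE2 (a b : ℚ) :
    IsSemialgebraicFunOn ℚ (line (Icc 0 1)) fun x => triE2 a b (x 0) := by
  refine isSemialgebraicFunOn_Icc_of_Ioo ?_ 0 0 (fun x hx => ?_) (fun x hx => ?_)
  · refine (((isSemialgebraicFunOn_const_of_isAlgebraic mix_line_sa
      (isAlgebraic_rat ℚ (2 * a - 2))).mul_holds (sa_triP2 a b)).add_holds (sa_triW2 a b)).congr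
      fun x hx => ?_
    have hx' : x 0 ∈ Ioo (0 : ℝ) 1 := hx
    simp only [triE2, if_pos hx', Pi.add_apply, Pi.mul_apply]
  · have h0 : x 0 ∉ Ioo (0 : ℝ) 1 := fun h => by rw [hx] at h; exact lt_irrefl _ h.1
    rw [triE2, if_neg h0, Rat.cast_zero]
  · have h0 : x 0 ∉ Ioo (0 : ℝ) 1 := fun h => by rw [hx] at h; exact lt_irrefl _ h.2
    rw [triE2, if_neg h0, Rat.cast_zero]

/-- `ρ₂'` is integrable on `[0,1]`. -/
theorem integrableOn_triE2 (a b : ℚ) (ha : 1 / 2 < a) (hb : 0 < b) (h : 3 * a + b = 3) :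
    IntegrableOn (triE2 a b) (Icc 0 1) := by
  rw [integrableOn_Icc_iff_integrableOn_Ioo]
  exact IntegrableOn.congr_fun
    (((integrableOn_triP2 a b (by linarith) hb h).const_mul ((((2 * a - 2 : ℚ)) : ℝ))).add
      (integrableOn_triW2 a b ha hb))
    (fun v hv => by simp only [triE2, if_pos hv, Pi.add_apply]) measurableSet_Ioo

end SoloBlind

end

end Summit.KontsevichZagierPeriods.KontsevichZagierPeriods.Theorems
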